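import Literature.NumberTheory.EllipticCurves.EtaQuotientQExpansionProofs
import Mathlib.RingTheory.PowerSeries.Expand
import HarnessLib

/-!
# Route `EisensteinDepletionAtTwo`, crux `StarGO2Sigma` (stmt-BirchSwinnertonDyer-27046), line `kummer` v7 —
# KF `stub_eulerClassLaw`: the `2`-adic Kummer class law of ONE Euler product,
# `F_t² − F_t(q²)·(1 + 2θ′_t) ∈ 4ℤ⟦q⟧`, `F_t = ∏_{n≥1}(1 − q^{tn})`, `θ′_t = Σ_{k≥1} q^{tk²}`

planner bsd-rank2-p2 GEN 38, PART 14 (evidence for 27046; the lead lands it `--supports 27046`).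

MECHANISM (finite, sorry-free): for the truncations `A_K = ∏_{k≤K}(1 − q^k)`, `B_K = ∏_{k≤K}(1 + q^k)`:
`1 − q^k = (1 + q^k)(1 − 2u_k)` with `u_k = q^k/(1+q^k) = Σ_{j≥1} (−1)^{j−1} q^{kj} ∈ ℤ⟦q⟧`, so `A_K = B_K·∏(1 − 2u_k)
= B_K(1 − 2S_K + 4W_K)`, `S_K = Σ_{k≤K} u_k`; `A_K B_K = A_K(q²)`; hence `A_K² − A_K(q²)(1 + 2θ′) = −2A_K B_K (S_K + θ′) + 4(…)`,
and `S_K + θ′ ≡ 0 (mod 2)` in degrees `≤ K` because `coeff_m S_K ≡ d(m) ≡ 𝟙[m = □] (mod 2)` (divisor pairing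
`(a, b) ↔ (b, a)` on `ab = m`).  The coefficients of `F = ∏_{n≥1}(1 − qⁿ)` (`formalEulerPow 1`) below `q^{K+1}` are those of
`A_K` (`coeff_formalEulerPow`); general `t` by `q ↦ q^t` (`PowerSeries.expand`).  [cite: Apostol1990, §14.3 (Gauss/Jacobi), §3.1–3.2]
HONEST FRAMING: pure `ℤ⟦q⟧` arithmetic; no elliptic curve; nothing about `StarGO2Sigma` / E1M / BSD is proved here.
-/

set_option autoImplicit false
set_option linter.dupNamespace false

noncomputable section

namespace Summit.BirchSwinnertonDyer.BirchSwinnertonDyer.Theorems.DepletionAtTwo.KEta.EulerClassLaw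

open PowerSeries Finset
open Literature.NumberTheory.EllipticCurves.ModularForms (formalEulerPow eulerTrunc formalEulerScaled coeff_formalEulerPow
  coeff_formalEulerScaled)

/-! ## §0 The theta pattern `θ′_δ` (verbatim the v7 design's `thetaSq`) -/

open Classical in
/-- `θ'_δ = Σ_{k ≥ 1} q^{δk²}`. [cite: Apostol1990, §14.3] -/
def thetaSq (δ : ℕ) : PowerSeries ℤ :=
  PowerSeries.mk fun n => if n ≠ 0 ∧ ∃ k : ℕ, n = δ * k ^ 2 then 1 else 0

/-! ## §1 The series `u_k = q^k/(1 + q^k)` and the truncated products -/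

open Classical in
/-- `u_k = Σ_{j≥1} (−1)^{j−1} q^{kj}` (`= q^k/(1+q^k)`). [folklore] -/
def useries (k : ℕ) : PowerSeries ℤ :=
  PowerSeries.mk fun m => if k ∣ m ∧ m ≠ 0 then (-1 : ℤ) ^ (m / k - 1) else 0

/-- Coefficients of `u_k`. [folklore] -/
theorem coeff_useries (k m : ℕ) :
    coeff m (useries k) = if k ∣ m ∧ m ≠ 0 then (-1 : ℤ) ^ (m / k - 1) else 0 := by
  classical
  rw [useries, coeff_mk]

/-- `(1 + q^k)·u_k = q^k` for `k ≥ 1`. [folklore] -/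
theorem one_add_X_pow_mul_useries {k : ℕ} (hk : 0 < k) :
    (1 + X ^ k) * useries k = (X : PowerSeries ℤ) ^ k := by
  classical
  ext m
  rw [add_mul, one_mul, map_add, coeff_X_pow_mul', coeff_useries, coeff_X_pow]
  by_cases hkm : k ∣ m
  · obtain ⟨j, rfl⟩ := hkm
    rcases Nat.eq_zero_or_pos j with hj | hj
    · subst hj
      simp only [Nat.mul_zero]
      rw [if_neg (fun h ↦ h.2 rfl), if_neg (by omega), if_neg (by omega)]; ring
    · have hkj : k * j ≠ 0 := Nat.mul_ne_zero hk.ne' hj.ne'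
      rw [if_pos ⟨dvd_mul_right k j, hkj⟩, Nat.mul_div_cancel_left j hk, if_pos (Nat.le_mul_of_pos_right k hj),
        coeff_useries, show k * j - k = k * (j - 1) by rw [Nat.mul_sub, mul_one]]
      rcases (Nat.succ_le_iff.mpr hj : 1 ≤ j).eq_or_lt with hj1 | hj1
      · subst hj1; simp
      · rw [if_pos ⟨dvd_mul_right k (j - 1), Nat.mul_ne_zero hk.ne' (by omega)⟩, Nat.mul_div_cancel_left (j - 1) hk,
          if_neg (by intro h; have := Nat.eq_of_mul_eq_mul_left hk (h.trans (mul_one k).symm); omega)]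
        obtain ⟨i, hi⟩ : ∃ i, j = i + 2 := ⟨j - 2, by omega⟩
        subst hi
        rw [show i + 2 - 1 = i + 1 from rfl, show i + 1 - 1 = i from rfl, pow_succ]
        ring
  · rw [if_neg (fun h ↦ hkm h.1)]
    have h2 : ¬ (k ∣ (m - k) ∧ m - k ≠ 0) := by
      rintro ⟨h, hne⟩
      apply hkm
      have hle : k ≤ m := by omega
      have := Nat.dvd_add h (dvd_refl k)
      rwa [Nat.sub_add_cancel hle] at this
    by_cases hle : k ≤ m
    · rw [if_pos hle, coeff_useries, if_neg h2, if_neg (by intro h; rw [h] at hkm; exact hkm (dvd_refl k))]; ring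
    · rw [if_neg hle, if_neg (by intro h; rw [h] at hkm; exact hkm (dvd_refl k))]; ring

/-- `1 − q^k = (1 + q^k)(1 − 2u_k)` for `k ≥ 1`. [folklore] -/
theorem one_sub_X_pow_eq {k : ℕ} (hk : 0 < k) :
    (1 : PowerSeries ℤ) - X ^ k = (1 + X ^ k) * (1 - 2 * useries k) := by
  have h := one_add_X_pow_mul_useries hk
  linear_combination (2 : PowerSeries ℤ) * h

/-- `∏ (1 − 2f_i) = 1 − 2Σ f_i + 4W`. [folklore] -/
theorem exists_prod_one_sub_two_mul {ι : Type*} [DecidableEq ι] (s : Finset ι) (f : ι → PowerSeries ℤ) :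
    ∃ W : PowerSeries ℤ, ∏ i ∈ s, (1 - 2 * f i) = 1 - 2 * ∑ i ∈ s, f i + 4 * W := by
  induction s using Finset.induction_on with
  | empty => exact ⟨0, by simp⟩
  | insert a s ha ih =>
    obtain ⟨W, hW⟩ := ih
    refine ⟨W * (1 - 2 * f a) + f a * ∑ i ∈ s, f i, ?_⟩
    rw [Finset.prod_insert ha, Finset.sum_insert ha, hW]
    ring

/-- `A_K = ∏_{k=1}^{K} (1 − q^k)`. [folklore] -/
def truncA (K : ℕ) : PowerSeries ℤ := ∏ m ∈ Finset.range K, (1 - (X : PowerSeries ℤ) ^ (m + 1))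

/-- `B_K = ∏_{k=1}^{K} (1 + q^k)`. [folklore] -/
def truncB (K : ℕ) : PowerSeries ℤ := ∏ m ∈ Finset.range K, (1 + (X : PowerSeries ℤ) ^ (m + 1))

/-- `S_K = Σ_{k=1}^{K} u_k`. [folklore] -/
def truncS (K : ℕ) : PowerSeries ℤ := ∑ m ∈ Finset.range K, useries (m + 1)

/-- `eulerTrunc 1 K = A_K`. [folklore] -/
theorem eulerTrunc_one (K : ℕ) : eulerTrunc 1 K = truncA K := by
  unfold eulerTrunc truncA
  exact Finset.prod_congr rfl fun _ _ ↦ pow_one _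

/-- `A_K·B_K = A_K(q²)`. [folklore] -/
theorem truncA_mul_truncB (K : ℕ) : truncA K * truncB K = expand 2 two_ne_zero (truncA K) := by
  unfold truncA truncB
  rw [← Finset.prod_mul_distrib, map_prod]
  refine Finset.prod_congr rfl fun m _ ↦ ?_
  rw [map_sub, map_one, map_pow, expand_X, ← pow_mul]
  ring

/-- **`A_K = B_K(1 − 2S_K) + 4·B_K·W_K`.** [folklore] -/
theorem exists_truncA_eq (K : ℕ) : ∃ W : PowerSeries ℤ, truncA K = truncB K * (1 - 2 * truncS K) + 4 * (truncB K * W) := by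
  classical
  obtain ⟨W, hW⟩ := exists_prod_one_sub_two_mul (Finset.range K) (fun m ↦ useries (m + 1))
  refine ⟨W, ?_⟩
  have hA : truncA K = truncB K * ∏ m ∈ Finset.range K, (1 - 2 * useries (m + 1)) := by
    unfold truncA truncB
    rw [← Finset.prod_mul_distrib]
    exact Finset.prod_congr rfl fun m _ ↦ one_sub_X_pow_eq (Nat.succ_pos m)
  rw [hA, hW, truncS]
  ring

/-! ## §2 Parities: `coeff_m S_K ≡ d(m) ≡ 𝟙[m = □] (mod 2)` for `1 ≤ m ≤ K` -/

/-- `coeff_m S_K = Σ_{d ∣ m} (−1)^{m/d − 1}` for `1 ≤ m ≤ K`. [folklore] -/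
theorem coeff_truncS {K m : ℕ} (hm : m ≠ 0) (hmK : m ≤ K) :
    coeff m (truncS K) = ∑ d ∈ m.divisors, (-1 : ℤ) ^ (m / d - 1) := by
  classical
  rw [truncS, map_sum]
  simp_rw [coeff_useries]
  rw [Finset.sum_ite, Finset.sum_const_zero, add_zero]
  refine Finset.sum_bij (fun k _ ↦ k + 1) ?_ ?_ ?_ ?_
  · intro k hk
    rw [Finset.mem_filter] at hk
    exact Nat.mem_divisors.mpr ⟨hk.2.1, hm⟩
  · intro a ha b hb h; simpa using h
  · intro d hd
    have hd' := Nat.mem_divisors.mp hd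
    have hdpos : 0 < d := Nat.pos_of_mem_divisors hd
    have hdle : d ≤ m := Nat.divisor_le hd
    exact ⟨d - 1, Finset.mem_filter.mpr ⟨Finset.mem_range.mpr (by omega), by rw [Nat.sub_add_cancel hdpos]; exact ⟨hd'.1, hm⟩⟩,
      Nat.sub_add_cancel hdpos⟩
  · intro k hk; rfl

/-- `Σ_{d ∣ m} (−1)^{m/d−1} ≡ d(m) (mod 2)`. [folklore] -/
theorem even_sum_neg_one_pow_sub_card (m : ℕ) :
    Even (∑ d ∈ m.divisors, (-1 : ℤ) ^ (m / d - 1) - (m.divisors.card : ℤ)) := by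
  rw [Finset.card_eq_sum_ones, Nat.cast_sum, ← Finset.sum_sub_distrib]
  refine Finset.even_sum _ fun d _ ↦ ?_
  rcases neg_one_pow_eq_or ℤ (m / d - 1) with h | h <;> rw [h] <;> decide

/-- **`d(m)` is odd iff `m` is a square** (`m ≥ 1`): the involution `(a, b) ↦ (b, a)` on `{ab = m}`.
[folklore] -/
theorem card_divisors_odd_iff {m : ℕ} (hm : m ≠ 0) : Odd m.divisors.card ↔ ∃ r : ℕ, m = r ^ 2 := by
  classical
  -- pass to the antidiagonal
  have hcard : m.divisors.card = (Nat.divisorsAntidiagonal m).card := by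
    rw [← Nat.map_div_right_divisors, Finset.card_map]
  rw [hcard]
  have hsplit : (Nat.divisorsAntidiagonal m).card =
      ((Nat.divisorsAntidiagonal m).filter fun x ↦ x.1 < x.2).card + ((Nat.divisorsAntidiagonal m).filter fun x ↦ x.1 = x.2).card +
      ((Nat.divisorsAntidiagonal m).filter fun x ↦ x.2 < x.1).card := by
    rw [← Finset.card_filter_add_card_filter_not (s := Nat.divisorsAntidiagonal m) (fun x ↦ x.1 < x.2), add_assoc]
    congr 1
    rw [← Finset.card_filter_add_card_filter_not (s := (Nat.divisorsAntidiagonal m).filter fun x ↦ ¬ x.1 < x.2)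
      (fun x ↦ x.1 = x.2), Finset.filter_filter, Finset.filter_filter]
    congr 2
    · ext x; simp only [Finset.mem_filter]; constructor
      · rintro ⟨h, -, h2⟩; exact ⟨h, h2⟩
      · rintro ⟨h, h2⟩; exact ⟨h, by omega, h2⟩
    · ext x; simp only [Finset.mem_filter]; constructor
      · rintro ⟨h, h1, h2⟩; exact ⟨h, by omega⟩
      · rintro ⟨h, h2⟩; exact ⟨h, by omega, by omega⟩
  have hswap : ((Nat.divisorsAntidiagonal m).filter fun x ↦ x.2 < x.1).card =
      ((Nat.divisorsAntidiagonal m).filter fun x ↦ x.1 < x.2).card := by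
    refine Finset.card_bij (fun x _ ↦ x.swap) ?_ ?_ ?_
    · intro x hx
      rw [Finset.mem_filter] at hx ⊢
      exact ⟨Nat.swap_mem_divisorsAntidiagonal.mpr hx.1, by simpa using hx.2⟩
    · intro x _ y _ h
      simpa using h
    · intro y hy
      rw [Finset.mem_filter] at hy
      exact ⟨y.swap, by rw [Finset.mem_filter]; exact ⟨Nat.swap_mem_divisorsAntidiagonal.mpr hy.1, by simpa using hy.2⟩,
        Prod.swap_swap y⟩
  have hdiag : ((Nat.divisorsAntidiagonal m).filter fun x ↦ x.1 = x.2).card = if ∃ r : ℕ, m = r ^ 2 then 1 else 0 := by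
    split_ifs with h
    · obtain ⟨r, hr⟩ := h
      rw [Finset.card_eq_one]
      refine ⟨(r, r), ?_⟩
      ext ⟨a, b⟩
      simp only [Finset.mem_filter, Nat.mem_divisorsAntidiagonal, Finset.mem_singleton, Prod.mk.injEq]
      constructor
      · rintro ⟨⟨hab, -⟩, rfl⟩
        have : a = r := by
          have h1 : a * a = r * r := by rw [hab, hr, sq]
          exact Nat.mul_self_inj.mp h1
        exact ⟨this, this⟩
      · rintro ⟨rfl, rfl⟩; exact ⟨⟨by rw [hr, sq], hm⟩, rfl⟩
    · rw [Finset.card_eq_zero, Finset.filter_eq_empty_iff]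
      rintro ⟨a, b⟩ hab heq
      simp only [Nat.mem_divisorsAntidiagonal] at hab
      simp only at heq
      subst heq
      exact h ⟨a, by rw [sq, hab.1]⟩
  rw [hsplit, hswap, hdiag]
  split_ifs with h
  · exact ⟨fun _ ↦ h, fun _ ↦ ⟨((Nat.divisorsAntidiagonal m).filter fun x ↦ x.1 < x.2).card, by ring⟩⟩
  · refine ⟨fun hodd ↦ absurd hodd ?_, fun h' ↦ absurd h' h⟩
    rw [add_zero, Nat.not_odd_iff_even]
    exact ⟨_, rfl⟩

open Classical in
/-- Coefficients of `θ'_1`. [folklore] -/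
theorem coeff_thetaSq_one (m : ℕ) : coeff m (thetaSq 1) = if m ≠ 0 ∧ ∃ r : ℕ, m = r ^ 2 then 1 else 0 := by
  classical
  rw [thetaSq, coeff_mk]
  simp only [one_mul]

/-- **`S_K + θ′ ≡ 0 (mod 2)` in degrees `≤ K`.** [folklore] -/
theorem two_dvd_coeff_truncS_add_thetaSq {K m : ℕ} (hmK : m ≤ K) : (2 : ℤ) ∣ coeff m (truncS K + thetaSq 1) := by
  classical
  rw [map_add, coeff_thetaSq_one]
  rcases eq_or_ne m 0 with rfl | hm
  · simp [truncS, coeff_useries]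
  rw [coeff_truncS hm hmK]
  have hev := even_sum_neg_one_pow_sub_card m
  have hpar := card_divisors_odd_iff hm
  by_cases hsq : ∃ r : ℕ, m = r ^ 2
  · rw [if_pos ⟨hm, hsq⟩]
    have hodd : Odd (m.divisors.card : ℤ) := (Int.odd_coe_nat _).mpr (hpar.mpr hsq)
    obtain ⟨a, ha⟩ := hev
    obtain ⟨b, hb⟩ := hodd
    exact ⟨a + b + 1, by linarith⟩
  · rw [if_neg (fun h ↦ hsq h.2), add_zero]
    have heven : Even (m.divisors.card : ℤ) := by
      have : ¬ Odd m.divisors.card := fun h ↦ hsq (hpar.mp h)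
      exact (Int.even_coe_nat _).mpr (Nat.not_odd_iff_even.mp this)
    obtain ⟨a, ha⟩ := hev
    obtain ⟨b, hb⟩ := heven
    exact ⟨a + b, by linarith⟩

/-! ## §3 The class law for `t = 1` -/

/-- Coefficient locality of products. [folklore] -/
theorem coeff_mul_eq_of_le {f f' g g' : PowerSeries ℤ} {n : ℕ} (hf : ∀ i ≤ n, coeff i f = coeff i f')
    (hg : ∀ i ≤ n, coeff i g = coeff i g') : coeff n (f * g) = coeff n (f' * g') := by
  rw [coeff_mul, coeff_mul]
  refine Finset.sum_congr rfl fun p hp ↦ ?_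
  rw [hf p.1 (Finset.HasAntidiagonal.antidiagonal.fst_le hp), hg p.2 (Finset.HasAntidiagonal.antidiagonal.snd_le hp)]

/-- `coeff_n F = coeff_n A_K` for `n ≤ K`. [folklore] -/
theorem coeff_formalEulerPow_one_eq {n K : ℕ} (h : n ≤ K) : coeff n (formalEulerPow 1) = coeff n (truncA K) := by
  rw [coeff_formalEulerPow h, eulerTrunc_one]

/-- `coeff_n F(q²) = coeff_n A_K(q²)` for `n ≤ K`. [folklore] -/
theorem coeff_expand_formalEulerPow_one_eq {n K : ℕ} (h : n ≤ K) :
    coeff n (expand 2 two_ne_zero (formalEulerPow 1)) = coeff n (expand 2 two_ne_zero (truncA K)) := by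
  rw [coeff_expand, coeff_expand]
  split_ifs with h2
  · exact coeff_formalEulerPow_one_eq ((Nat.div_le_self n 2).trans h)
  · rfl

/-- `4 ∣ coeff_n (2·X·Y)` when the coefficients of `Y` in degrees `≤ n` are even. [folklore] -/
theorem four_dvd_coeff_two_mul {F G : PowerSeries ℤ} {n : ℕ} (hG : ∀ j ≤ n, (2 : ℤ) ∣ coeff j G) :
    (4 : ℤ) ∣ coeff n (2 * (F * G)) := by
  rw [show (2 : PowerSeries ℤ) = C (2 : ℤ) from (map_ofNat C 2).symm, coeff_C_mul, coeff_mul, Finset.mul_sum]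
  refine Finset.dvd_sum fun p hp ↦ ?_
  obtain ⟨c, hc⟩ := hG p.2 (Finset.HasAntidiagonal.antidiagonal.snd_le hp)
  exact ⟨coeff p.1 F * c, by rw [hc]; ring⟩

/-- **KF at `t = 1`**: `F² − F(q²)(1 + 2θ′₁) ∈ 4ℤ⟦q⟧` for `F = ∏_{n≥1}(1 − qⁿ)`. [cite: Apostol1990, §14.3] -/
theorem eulerClassLaw_one (n : ℕ) :
    (4 : ℤ) ∣ coeff n (formalEulerPow 1 ^ 2 - expand 2 two_ne_zero (formalEulerPow 1) * (1 + 2 * thetaSq 1)) := by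
  obtain ⟨W, hW⟩ := exists_truncA_eq n
  have hAB := truncA_mul_truncB n
  have h1 : coeff n (formalEulerPow 1 ^ 2 - expand 2 two_ne_zero (formalEulerPow 1) * (1 + 2 * thetaSq 1)) =
      coeff n (truncA n ^ 2 - expand 2 two_ne_zero (truncA n) * (1 + 2 * thetaSq 1)) := by
    rw [map_sub, map_sub, sq, sq, coeff_mul_eq_of_le (fun i hi ↦ coeff_formalEulerPow_one_eq hi)
      (fun i hi ↦ coeff_formalEulerPow_one_eq hi), coeff_mul_eq_of_le (fun i hi ↦ coeff_expand_formalEulerPow_one_eq hi)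
      (fun i _ ↦ rfl)]
  have hid : truncA n ^ 2 - expand 2 two_ne_zero (truncA n) * (1 + 2 * thetaSq 1) =
      -(2 * ((truncA n * truncB n) * (truncS n + thetaSq 1))) + 4 * (truncA n * truncB n * W) := by
    linear_combination (truncA n) * hW + (1 + 2 * thetaSq 1) * hAB
  rw [h1, hid, map_add, map_neg]
  refine dvd_add (dvd_neg.mpr (four_dvd_coeff_two_mul fun j hj ↦ two_dvd_coeff_truncS_add_thetaSq hj)) ?_
  rw [show (4 : PowerSeries ℤ) = C (4 : ℤ) from (map_ofNat C 4).symm, coeff_C_mul]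
  exact dvd_mul_right 4 _

/-! ## §4 General `t` by `q ↦ q^t` -/

/-- `F_t = F(q^t)` for `t ≥ 1`. [folklore] -/
theorem formalEulerScaled_eq_expand {t : ℕ} (ht : t ≠ 0) : formalEulerScaled t = expand t ht (formalEulerPow 1) := by
  ext m
  rw [coeff_formalEulerScaled, coeff_expand]

/-- `θ′_t = θ′₁(q^t)` for `t ≥ 1`. [folklore] -/
theorem thetaSq_eq_expand {t : ℕ} (ht : t ≠ 0) : thetaSq t = expand t ht (thetaSq 1) := by
  classical
  ext m
  simp only [thetaSq, coeff_mk, coeff_expand, one_mul]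
  by_cases htm : t ∣ m
  · obtain ⟨j, rfl⟩ := htm
    rw [if_pos (dvd_mul_right t j)]
    simp only [Nat.mul_div_cancel_left j (Nat.pos_of_ne_zero ht)]
    by_cases hj : j ≠ 0 ∧ ∃ k : ℕ, j = k ^ 2
    · rw [if_pos hj, if_pos]
      obtain ⟨hj0, k, hk⟩ := hj
      exact ⟨Nat.mul_ne_zero ht hj0, k, by rw [hk]⟩
    · rw [if_neg hj, if_neg]
      rintro ⟨hne, k, hk⟩
      exact hj ⟨fun h ↦ hne (by rw [h, mul_zero]), k, Nat.eq_of_mul_eq_mul_left (Nat.pos_of_ne_zero ht) hk⟩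
  · rw [if_neg htm, if_neg]
    rintro ⟨-, k, hk⟩
    exact htm ⟨k ^ 2, hk⟩

/-- `expand t ∘ expand 2 = expand 2 ∘ expand t`. [folklore] -/
theorem expand_comm (f : PowerSeries ℤ) {t : ℕ} (ht : t ≠ 0) :
    expand t ht (expand 2 two_ne_zero f) = expand 2 two_ne_zero (expand t ht f) := by
  rw [← expand_mul, ← expand_mul]
  have key : ∀ (a b : ℕ) (ha : a ≠ 0) (hb : b ≠ 0), a = b → expand a ha f = expand b hb f := by
    rintro a b ha hb rfl; rfl
  exact key _ _ _ _ (Nat.mul_comm t 2)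

/-- `F_0 = 1`. [folklore] -/
theorem formalEulerScaled_zero : formalEulerScaled 0 = 1 := by
  ext m
  rw [coeff_formalEulerScaled, coeff_one, Nat.div_zero, coeff_zero_eq_constantCoeff_apply,
    Literature.NumberTheory.EllipticCurves.ModularForms.constantCoeff_formalEulerPow]
  simp only [zero_dvd_iff]

/-- `θ′_0 = 0`. [folklore] -/
theorem thetaSq_zero : thetaSq 0 = 0 := by
  classical
  ext m
  simp only [thetaSq, coeff_mk, zero_mul, map_zero]
  rw [if_neg]
  rintro ⟨hne, k, hk⟩
  exact hne hk

/-- **KF `stub_eulerClassLaw`**: `F_t² − F_t(q²)(1 + 2θ′_t) ∈ 4ℤ⟦q⟧` for every `t` (`t = 0`: `1 − 1 = 0`).  Literally the v7 stub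
(with the v7 design's `thetaSq`). [cite: Apostol1990, §14.3 (Gauss), §3.1–3.2] -/
theorem eulerClassLaw (t n : ℕ) :
    (4 : ℤ) ∣ coeff n (formalEulerScaled t ^ 2 - expand 2 two_ne_zero (formalEulerScaled t) * (1 + 2 * thetaSq t)) := by
  rcases eq_or_ne t 0 with rfl | ht
  · rw [formalEulerScaled_zero, thetaSq_zero, one_pow, map_one, mul_zero, add_zero, mul_one, sub_self, map_zero]
    exact dvd_zero 4
  have key : formalEulerScaled t ^ 2 - expand 2 two_ne_zero (formalEulerScaled t) * (1 + 2 * thetaSq t) =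
      expand t ht (formalEulerPow 1 ^ 2 - expand 2 two_ne_zero (formalEulerPow 1) * (1 + 2 * thetaSq 1)) := by
    rw [formalEulerScaled_eq_expand ht, thetaSq_eq_expand ht, map_sub, map_pow, map_mul, map_add, map_one, map_mul,
      expand_comm _ ht, map_ofNat]
  rw [key, coeff_expand]
  split_ifs with h
  · exact eulerClassLaw_one _
  · exact dvd_zero 4

end Summit.BirchSwinnertonDyer.BirchSwinnertonDyer.Theorems.DepletionAtTwo.KEta.EulerClassLaw
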